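import Mathlib
import Literature.NumberTheory.Automorphic.HilbertModularFormQExpansion

/-!
# The height-minimum survives the perturbation `δ = M + ω`, `M ≫ 0` (stub U5 of line Sketch-ideate-r1-k1)

Crux `HilbertIntegralOverconvergentIsCongruence` (stmt-Langlands-8485), line `Sketch-ideate-r1-k1`,
§ U (supply from one seed form).  For a totally real number field `F` a weight vector `y ≫ 0` on the
real embeddings `σ : F →+* ℝ` defines the height `λ_y ν = ∑_σ y_σ σ(ν)`.  The `q`-expansion support
`S` of a seed Hilbert modular form is a set of totally positive elements of `F` with finite sublevel
sets of `λ_y` and (for generic `y`) a STRICT `λ_y`-minimum `νs`.  The line rescales the seed by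
`δ = M + ω` (`ω` in a fixed finite set `Ω`, `M` a large natural number) and needs that `δ` is totally
positive and that `ν ↦ λ_y(δ ν)` still has its strict minimum over `S` at `νs`.

* `stub_lead_perturb` (registered stub U5) — the statement above.

Proof.  `λ_y((M+ω)ν) = M λ_y ν + E_ω ν` with `E_ω ν = ∑_σ y_σ σ(ω) σ(ν)` (the `σ` are ring
homomorphisms, `lpt_height_expand`), and `|σ ω| ≤ C := ∑_{ω' ∈ Ω} ∑_{σ'} |σ' ω'|`
(`lpt_abs_conj_le`), so `-C λ_y ν ≤ E_ω ν ≤ C λ_y ν` for totally positive `ν`.  Hence it suffices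
that `C (λ_y ν + λ_y νs) < M (λ_y ν − λ_y νs)` for `ν ∈ S ∖ {νs}`.  The finitely many `ν ≠ νs` in
`S` with `λ_y ν ≤ 3 λ_y νs` have a uniform positive gap `g ≤ λ_y ν − λ_y νs` (`lpt_exists_pos_le`),
and then `C (λ_y ν + λ_y νs) ≤ 4 C λ_y νs < M g` once `M > 4 C λ_y νs / g`; the others satisfy
`3 λ_y νs < λ_y ν`, and `M ≥ 2 C + 1` suffices.  Total positivity of `M + ω` holds as soon as
`M > C`.  The threshold is `M₀ = ⌈2 C + 4 C λ_y νs / g⌉₊ + 1`.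

Theorems only, no `sorry`.
-/

set_option linter.dupNamespace false

noncomputable section

namespace Summit.Langlands.Langlands.Theorems.HilbertIntegralOverconvergentIsCongruence

open NumberField

/-- A real function that is positive on a finite set admits a uniform positive lower bound on it
(the bound `1` if the set is empty, the minimum otherwise). -/
theorem lpt_exists_pos_le {α : Type} (T : Finset α) (f : α → ℝ) (hf : ∀ x ∈ T, 0 < f x) :
    ∃ g : ℝ, 0 < g ∧ ∀ x ∈ T, g ≤ f x := by
  rcases T.eq_empty_or_nonempty with rfl | hne
  · exact ⟨1, one_pos, fun x hx ↦ absurd hx (Finset.notMem_empty x)⟩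
  · obtain ⟨x₀, hx₀, hmin⟩ := T.exists_min_image f hne
    exact ⟨f x₀, hf x₀ hx₀, hmin⟩

/-- Expansion of the height of `(M + ω) ν` along the ring homomorphisms `σ : F →+* ℝ`:
`∑_σ y_σ σ((M + ω) ν) = M ∑_σ y_σ σ(ν) + ∑_σ y_σ σ(ω) σ(ν)`. -/
theorem lpt_height_expand (F : Type) [Field F] [NumberField F] (y : (F →+* ℝ) → ℝ) (M : ℕ)
    (ω ν : F) :
    ∑ σ : F →+* ℝ, y σ * σ (((M : F) + ω) * ν) =
      (M : ℝ) * ∑ σ : F →+* ℝ, y σ * σ ν + ∑ σ : F →+* ℝ, y σ * σ ω * σ ν := by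
  rw [Finset.mul_sum, ← Finset.sum_add_distrib]
  refine Finset.sum_congr rfl fun σ _ ↦ ?_
  rw [map_mul, map_add, map_natCast]
  ring

/-- A uniform bound for the real conjugates of the elements of a finite set `Ω ⊆ F`:
`|σ ω| ≤ ∑_{ω' ∈ Ω} ∑_{σ'} |σ' ω'|` for `ω ∈ Ω`. -/
theorem lpt_abs_conj_le (F : Type) [Field F] [NumberField F] (Ω : Finset F) {ω : F} (hω : ω ∈ Ω)
    (σ : F →+* ℝ) : |σ ω| ≤ ∑ ω' ∈ Ω, ∑ σ' : F →+* ℝ, |σ' ω'| :=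
  calc |σ ω| ≤ ∑ σ' : F →+* ℝ, |σ' ω| :=
        Finset.single_le_sum (f := fun σ' : F →+* ℝ ↦ |σ' ω|) (fun _ _ ↦ abs_nonneg _)
          (Finset.mem_univ σ)
    _ ≤ ∑ ω' ∈ Ω, ∑ σ' : F →+* ℝ, |σ' ω'| :=
        Finset.single_le_sum (f := fun ω' ↦ ∑ σ' : F →+* ℝ, |σ' ω'|)
          (fun _ _ ↦ Finset.sum_nonneg fun _ _ ↦ abs_nonneg _) hω

/-- **stub U5 — `stub_lead_perturb` (M; the leading exponent of `s(δz)` for `δ = M + ω`, `M ≫ 0`).**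
`y ≫ 0` a height, `S ⊆ F` a set of totally positive elements with finite sublevel sets
`{ν ∈ S : λ_y ν ≤ t}` and a STRICT `λ_y`-minimum `νs` (`λ_y ν = ∑_σ y_σ σ(ν)`), `Ω ⊆ F` finite.  Then
for all large `M ∈ ℕ` and all `ω ∈ Ω`: `M + ω` is totally positive and `ν ↦ λ_y((M + ω)ν)` still
attains its strict minimum over `S` at `νs` — since
`λ_y((M+ω)ν) − λ_y((M+ω)νs) = M(λ_y ν − λ_y νs) + (λ_y(ων) − λ_y(ωνs))`, `|λ_y(ων)| ≤ C λ_y ν` on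
totally positive `ν`, the finitely many `ν ∈ S ∖ {νs}` with `λ_y ν ≤ 3 λ_y νs` have a positive gap,
and the others satisfy `3 (λ_y ν − λ_y νs) > 2 λ_y ν > 0`. [folklore] -/
theorem stub_lead_perturb (F : Type) [Field F] [NumberField F] [NumberField.IsTotallyReal F]
    (y : (F →+* ℝ) → ℝ) (hy : ∀ σ, 0 < y σ) (S : Set F) (hS : ∀ ν ∈ S, ∀ σ : F →+* ℝ, 0 < σ ν)
    (hSfin : ∀ t : ℝ, {ν : F | ν ∈ S ∧ ∑ σ : F →+* ℝ, y σ * σ ν ≤ t}.Finite)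
    (νs : F) (hνs : νs ∈ S)
    (hmin : ∀ ν ∈ S, ν ≠ νs → ∑ σ : F →+* ℝ, y σ * σ νs < ∑ σ : F →+* ℝ, y σ * σ ν)
    (Ω : Finset F) :
    ∃ M₀ : ℕ, ∀ M : ℕ, M₀ ≤ M → ∀ ω ∈ Ω,
      (∀ σ : F →+* ℝ, 0 < σ ((M : F) + ω)) ∧
      ∀ ν ∈ S, ν ≠ νs →
        ∑ σ : F →+* ℝ, y σ * σ (((M : F) + ω) * νs) < ∑ σ : F →+* ℝ, y σ * σ (((M : F) + ω) * ν) := by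
  classical
  -- a uniform bound `C ≥ 0` for the real conjugates of the `ω ∈ Ω`
  obtain ⟨C, hC0, hCb⟩ : ∃ C : ℝ, 0 ≤ C ∧ ∀ ω ∈ Ω, ∀ σ : F →+* ℝ, |σ ω| ≤ C :=
    ⟨∑ ω' ∈ Ω, ∑ σ' : F →+* ℝ, |σ' ω'|,
      Finset.sum_nonneg fun _ _ ↦ Finset.sum_nonneg fun _ _ ↦ abs_nonneg _,
      fun ω hω σ ↦ lpt_abs_conj_le F Ω hω σ⟩
  -- the height is nonnegative on `S`
  have hLnn : ∀ ν ∈ S, 0 ≤ ∑ σ : F →+* ℝ, y σ * σ ν := fun ν hν ↦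
    Finset.sum_nonneg fun σ _ ↦ (mul_pos (hy σ) (hS ν hν σ)).le
  have hLs0 : 0 ≤ ∑ σ : F →+* ℝ, y σ * σ νs := hLnn νs hνs
  -- the finitely many competitors `ν ≠ νs` of height `≤ 3 λ νs` have a uniform positive gap `g`
  obtain ⟨g, hg0, hg⟩ : ∃ g : ℝ, 0 < g ∧ ∀ ν ∈ S, ν ≠ νs →
      ∑ σ : F →+* ℝ, y σ * σ ν ≤ 3 * ∑ σ : F →+* ℝ, y σ * σ νs →
      g ≤ (∑ σ : F →+* ℝ, y σ * σ ν) - ∑ σ : F →+* ℝ, y σ * σ νs := by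
    obtain ⟨g, hg0, hg⟩ := lpt_exists_pos_le
      ((hSfin (3 * ∑ σ : F →+* ℝ, y σ * σ νs)).toFinset.erase νs)
      (fun ν ↦ (∑ σ : F →+* ℝ, y σ * σ ν) - ∑ σ : F →+* ℝ, y σ * σ νs) fun ν hν ↦ by
        rw [Finset.mem_erase, Set.Finite.mem_toFinset, Set.mem_setOf_eq] at hν
        exact sub_pos.2 (hmin ν hν.2.1 hν.1)
    exact ⟨g, hg0, fun ν hν hne hle ↦ hg ν (by
      rw [Finset.mem_erase, Set.Finite.mem_toFinset, Set.mem_setOf_eq]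
      exact ⟨hne, hν, hle⟩)⟩
  -- the threshold `x = 2 C + 4 C λ νs / g`
  obtain ⟨x, hxC, hxg⟩ : ∃ x : ℝ, 2 * C ≤ x ∧ 4 * C * (∑ σ : F →+* ℝ, y σ * σ νs) / g ≤ x :=
    ⟨2 * C + 4 * C * (∑ σ : F →+* ℝ, y σ * σ νs) / g,
      le_add_of_nonneg_right (div_nonneg (mul_nonneg (mul_nonneg (by norm_num) hC0) hLs0) hg0.le),
      le_add_of_nonneg_left (mul_nonneg (by norm_num) hC0)⟩
  refine ⟨⌈x⌉₊ + 1, fun M hM ω hω ↦ ?_⟩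
  have hMx : x + 1 ≤ (M : ℝ) := by
    have h1 : ((⌈x⌉₊ + 1 : ℕ) : ℝ) ≤ (M : ℝ) := Nat.cast_le.2 hM
    push_cast at h1
    linarith [Nat.le_ceil x]
  have hM0 : (0 : ℝ) ≤ (M : ℝ) := Nat.cast_nonneg M
  have hσω : ∀ σ : F →+* ℝ, -C ≤ σ ω ∧ σ ω ≤ C := fun σ ↦ abs_le.1 (hCb ω hω σ)
  refine ⟨fun σ ↦ ?_, fun ν hν hne ↦ ?_⟩
  · -- total positivity of `M + ω`: `σ (M + ω) = M + σ ω ≥ M - C > 0`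
    rw [map_add, map_natCast]
    linarith [(hσω σ).1]
  · rw [lpt_height_expand F y M ω νs, lpt_height_expand F y M ω ν]
    have hLν0 : 0 ≤ ∑ σ : F →+* ℝ, y σ * σ ν := hLnn ν hν
    -- the error terms `E_ω ν ≥ -C λ ν` and `E_ω νs ≤ C λ νs`
    have hElow : -C * ∑ σ : F →+* ℝ, y σ * σ ν ≤ ∑ σ : F →+* ℝ, y σ * σ ω * σ ν := by
      rw [Finset.mul_sum]
      exact Finset.sum_le_sum fun σ _ ↦
        calc -C * (y σ * σ ν) ≤ σ ω * (y σ * σ ν) :=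
              mul_le_mul_of_nonneg_right (hσω σ).1 (mul_pos (hy σ) (hS ν hν σ)).le
          _ = y σ * σ ω * σ ν := by ring
    have hEup : ∑ σ : F →+* ℝ, y σ * σ ω * σ νs ≤ C * ∑ σ : F →+* ℝ, y σ * σ νs := by
      rw [Finset.mul_sum]
      exact Finset.sum_le_sum fun σ _ ↦
        calc y σ * σ ω * σ νs = σ ω * (y σ * σ νs) := by ring
          _ ≤ C * (y σ * σ νs) :=
              mul_le_mul_of_nonneg_right (hσω σ).2 (mul_pos (hy σ) (hS νs hνs σ)).le
    -- the main estimate `C (λ ν + λ νs) < M (λ ν - λ νs)`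
    have hmain : C * (∑ σ : F →+* ℝ, y σ * σ ν) + C * (∑ σ : F →+* ℝ, y σ * σ νs) <
        (M : ℝ) * ((∑ σ : F →+* ℝ, y σ * σ ν) - ∑ σ : F →+* ℝ, y σ * σ νs) := by
      by_cases hcase : ∑ σ : F →+* ℝ, y σ * σ ν ≤ 3 * ∑ σ : F →+* ℝ, y σ * σ νs
      · -- a competitor of small height: use the gap `g` and `M g > 4 C λ νs`
        have h1 : 4 * C * (∑ σ : F →+* ℝ, y σ * σ νs) ≤ x * g := (div_le_iff₀ hg0).1 hxg
        have h2 : x * g < (M : ℝ) * g := mul_lt_mul_of_pos_right (by linarith) hg0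
        have h3 := mul_le_mul_of_nonneg_left (hg ν hν hne hcase) hM0
        have h4 := mul_le_mul_of_nonneg_left hcase hC0
        linarith
      · -- a competitor of large height: `3 λ νs < λ ν` and `M ≥ 2 C + 1`
        rw [not_le] at hcase
        have h1 : (2 * C + 1) * ∑ σ : F →+* ℝ, y σ * σ ν ≤ (M : ℝ) * ∑ σ : F →+* ℝ, y σ * σ ν :=
          mul_le_mul_of_nonneg_right (by linarith) hLν0
        have h2 := mul_le_mul_of_nonneg_left hcase.le hM0
        have h3 := mul_le_mul_of_nonneg_left hcase.le hC0
        linarith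
    linarith

end Summit.Langlands.Langlands.Theorems.HilbertIntegralOverconvergentIsCongruence
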